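import Summits.BirchSwinnertonDyer.BirchSwinnertonDyer.Theses.KolyvaginRankRigidityAtTwo
import HarnessLib

/-!
# TURNKEY (lead krr2-p1 g6) for the pen of route `KolyvaginRankRigidityAtTwo` — recommendation R4:
# the MARGIN restatement of the pair (V1′, V2♭) at `p = 2`, with the deciding theorem re-checked

WHY. Kolyvagin, Math. Ann. 291 (1991), p. 259, on the theory for an ARBITRARY prime `ℓ` (here `ℓ = 2`):
*"There exists `k(r) ≥ k₀` such that the condition (2.1) [strong non-vanishing at depth `r`] is
equivalent to the condition that `∃n : V^r_{n,k(r)} ≠ 0`. We know that, for `ℓ ∈ B(E)`, `k(r) = 0`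
satisfies this property."* — i.e. at `2` a Kolyvagin class certifies the structure theory only when
it is non-zero WITH A LEVEL MARGIN `k(r)` (`M + k ≤ M(n)`); a margin-`0` class (all that V1′ / V2♭ as
filed provide / assume) may be a phantom (the inflated `ℤ/2 = H¹(K(E[2^M])/K, E[2^M])`, Lawson–Wuthrich)
or too small to propagate through Kolyvagin's prime-replacement step, which at `2` loses `O(1)` bits
(Čebotarev `(1 ± τ)E[2^M]`, local pairing `e((1+τ)g,(1−τ)g)` of order `2^{M−1}`). So the provable
shape of the pair at `2` is:

* `KolyvaginNonvanishingAtTwoFrameStrong` (V1′ₛ) = V1′ with `∀ k, ∃` a non-zero class of margin `k`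
  (`M + k ≤ M(n)`) — Kolyvagin's "strong non-zero system" (Conj. 2.5, stated by him for all `ℓ`); any
  proof of Kolyvagin's conjecture at `2` (Iwasawa-theoretic `κ^∞ ≠ 0`, or rank-lowering) yields it;
* `KolyvaginCorankLowerBoundAtTwoMargin` (V2♭ₘ) = V2♭ with `∃ k` (chosen by the prover, per curve and
  field) such that the lower bound holds for non-zero classes OF MARGIN `k` that are depth-minimal
  AMONG margin-`k` classes — WEAKER than V2♭ (`margin_of_lowerBound`: take `k = 0`), and exactly what
  Kolyvagin's window argument at `2` (line `kolyvagin_depth_split`, stub T5⁺) can deliver.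

`closes_margin` is the route's deciding theorem `closes` VERBATIM with (V1′, V2♭) replaced by
(V1′ₛ, V2♭ₘ): it still concludes the leaf `Rank1Residual.NonCMTwoConverse` (get `k` from V2♭ₘ, a
margin-`k` class from V1′ₛ, a depth-minimal one among margin-`k` classes, then `ν = 0` as before).
This file is EVIDENCE for a route edit (items are the planner's, D-0014); it defines the two candidate
texts locally and is not a Theorems landing. BSD is not proved by any of this.
-/

set_option linter.dupNamespace false

namespace Summit.BirchSwinnertonDyer.BirchSwinnertonDyer.Theses.KolyvaginRankRigidityAtTwo.MarginTurnkey

open scoped BigOperators Classical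
open Summit.BirchSwinnertonDyer.BirchSwinnertonDyer.Theses.KolyvaginRankRigidityAtTwo Literature

/-- **V1′ₛ — Kolyvagin's conjecture at `2` in STRONG form** (candidate replacement text for item
24622 `KolyvaginNonvanishingAtTwoFrame`): for every margin `k` there is a non-zero class `c_M(n)` with
`M + k ≤ M(n)`. [cite: Kolyvagin1991MathAnn, p. 259, Conj. 2.5 and the definition of k(r)] -/
def KolyvaginNonvanishingAtTwoFrameStrong : Prop :=
  ∀ (W : WeierstrassCurve ℚ) [W.IsElliptic] [W.IsGloballyMinimal], ¬ W.HasCM → (Literature.NumberTheory.EllipticCurves.Rank1Residual.GoodOrd W 2 ∨ Literature.NumberTheory.EllipticCurves.Rank1Residual.Mult W 2) → (∀ m : ℕ, W.HasSurjectiveModNGaloisRep (2 ^ m : ℕ)) → ∀ (K : Type) [Field K] [NumberField K], Literature.NumberTheory.EllipticCurves.IsImaginaryQuadratic K → ∀ [NeZero (W.conductorNorm ℤ)], Literature.NumberTheory.EllipticCurves.SatisfiesHeegnerHypothesis (W.conductorNorm ℤ) K → Odd (NumberField.discr K) → NumberField.discr K ≠ -3 → AddSubgroup.torsionBy (W.baseChange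 K).toAffine.Point (2 : ℤ) = ⊥ → Literature.NumberTheory.EllipticCurves.SatisfiesHeegnerHypothesis 2 K → ∀ (Dt : Literature.NumberTheory.EllipticCurves.ModularForms.ModularParametrizationData W (W.conductorNorm ℤ)) (β : ℤ) (ι : K →+* ℂ), (4 * (W.conductorNorm ℤ : ℤ)) ∣ β ^ 2 - NumberField.discr K → ∀ k : ℕ, ∃ (n : ℕ) (d : Literature.NumberTheory.EllipticCurves.KolyvaginHeegnerData Dt β ι n) (M : ℕ), Literature.NumberTheory.EllipticCurves.KolyvaginDescent.KolSupp (Literature.NumberTheory.EllipticCurves.Zhang2014.IsKolyvaginPrime (W.conductorNorm ℤ) W K 2) n ∧ 1 ≤ M ∧ ((M + k : ℕ) : ℕ∞) ≤ Literature.NumberTheory.EllipticCurves.Zhang2014.levelIndex W 2 n ∧ d.kolyvaginClass Nat.prime_two M ≠ 0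

/-- **V2♭ₘ — the corank lower bound at `2` for classes WITH MARGIN** (candidate replacement text for
item 24623 `KolyvaginCorankLowerBoundAtTwo`): for some margin `k` (depending on the curve and the
field), a non-zero class `c_M(n)` with `M + k ≤ M(n)` whose depth is minimal among such classes has
`ν + 1 ≤ c ∨ ν + 1 ≤ c'`. [cite: Kolyvagin1991MathAnn, §2 Thm. 2.2–2.3 and p. 259] -/
def KolyvaginCorankLowerBoundAtTwoMargin : Prop :=
  ∀ (W : WeierstrassCurve ℚ) [W.IsElliptic] [W.IsGloballyMinimal], ¬ W.HasCM → (Literature.NumberTheory.EllipticCurves.Rank1Residual.GoodOrd W 2 ∨ Literature.NumberTheory.EllipticCurves.Rank1Residual.Mult W 2) → (∀ m : ℕ, W.HasSurjectiveModNGaloisRep (2 ^ m : ℕ)) → ∀ (K : Type) [Field K] [NumberField K], Literature.NumberTheory.EllipticCurves.IsImaginaryQuadratic K → NumberField.discr K ≠ -3 → NumberField.discr K ≠ -4 → ¬ ((2 : ℤ) ∣ NumberField.discr K) → ∀ [NeZero (W.conductorNorm ℤ)], Literature.NumberTheory.EllipticCurves.SatisfiesHeegnerHypothesis (W.conductorNorm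 ℤ) K → ∃ k : ℕ, ∀ (Dt : Literature.NumberTheory.EllipticCurves.ModularForms.ModularParametrizationData W (W.conductorNorm ℤ)) (β : ℤ) (ι : K →+* ℂ) (n : ℕ) (d : Literature.NumberTheory.EllipticCurves.KolyvaginHeegnerData Dt β ι n) (M : ℕ), Literature.NumberTheory.EllipticCurves.KolyvaginDescent.KolSupp (Literature.NumberTheory.EllipticCurves.Zhang2014.IsKolyvaginPrime (W.conductorNorm ℤ) W K 2) n → 1 ≤ M → ((M + k : ℕ) : ℕ∞) ≤ Literature.NumberTheory.EllipticCurves.Zhang2014.levelIndex W 2 n → d.kolyvaginClass Nat.prime_two M ≠ 0 → (∀ (n' : ℕ) (d' : Literature.NumberTheory.EllipticCurves.KolyvaginHeegnerData Dt β ι n') (M' : ℕ), Literature.NumberTheory.EllipticCurves.KolyvaginDescent.KolSupp (Literature.NumberTheory.EllipticCurves.Zhang2014.IsKolyvaginPrime (W.conductorNorm ℤ) W K 2) n' → 1 ≤ M' → ((M' + k : ℕ) : ℕ∞) ≤ Literature.NumberTheory.EllipticCurves.Zhang2014.levelIndex W 2 n' → d'.kolyvaginClass Nat.prime_two M' ≠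 0 → n.primeFactors.card ≤ n'.primeFactors.card) → (n.primeFactors.card + 1 ≤ W.selmerCorank 2 ∨ n.primeFactors.card + 1 ≤ (W.quadraticTwist (NumberField.discr K : ℚ)).selmerCorank 2)

/-- V2♭ (as filed) implies V2♭ₘ (take `k = 0`): the restatement is a WEAKENING of the crux.
[cite: Kolyvagin1991MathAnn, §2] -/
theorem margin_of_lowerBound (h : KolyvaginCorankLowerBoundAtTwo) :
    KolyvaginCorankLowerBoundAtTwoMargin := by
  intro W _ _ hCM hred hsur K _ _ hK hne3 hne4 h2d _ hHN
  refine ⟨0, fun Dt β ι n d M hn hM1 hMle hne hmin ↦ ?_⟩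
  refine h W hCM hred hsur K hK hne3 hne4 h2d hHN Dt β ι n d M hn hM1 (by simpa using hMle) hne
    fun n' d' M' hn' hM1' hMle' hne' ↦ hmin n' d' M' hn' hM1' (by simpa using hMle') hne'

/-- V1′ₛ implies V1′ (as filed) (take `k = 0`): the restatement is a STRENGTHENING of the
non-vanishing crux. [cite: Kolyvagin1991MathAnn, p. 259] -/
theorem frame_of_strong (h : KolyvaginNonvanishingAtTwoFrameStrong) :
    KolyvaginNonvanishingAtTwoFrame := by
  intro W _ _ hCM hred hsur K _ _ hK _ hHN hodd hne3 htor hH2 Dt β ι hβ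
  obtain ⟨n, d, M, hn, hM1, hMle, hne⟩ := h W hCM hred hsur K hK hHN hodd hne3 htor hH2 Dt β ι hβ 0
  exact ⟨n, d, M, hn, hM1, by simpa using hMle, hne⟩

/-- A non-zero class of margin `k` of MINIMAL depth among the non-zero classes of margin `k`
(well-ordering of `ℕ`; margin variant of `heegnerSystem_exists_minimal_kolyvaginClass_ne_zero`).
[folklore] -/
theorem exists_minimal_kolyvaginClass_ne_zero_margin {W : WeierstrassCurve ℚ}
    [W.IsGloballyMinimal] [NeZero (W.conductorNorm ℤ)] {K : Type} [Field K] [NumberField K]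
    {Dt : Literature.NumberTheory.EllipticCurves.ModularForms.ModularParametrizationData W (W.conductorNorm ℤ)}
    {β : ℤ} {ι : K →+* ℂ} (k : ℕ) {n : ℕ}
    (d : Literature.NumberTheory.EllipticCurves.KolyvaginHeegnerData Dt β ι n) {M : ℕ}
    (hn : Literature.NumberTheory.EllipticCurves.KolyvaginDescent.KolSupp
      (Literature.NumberTheory.EllipticCurves.Zhang2014.IsKolyvaginPrime (W.conductorNorm ℤ) W K 2) n)
    (hM : 1 ≤ M)
    (hMle : ((M + k : ℕ) : ℕ∞) ≤ Literature.NumberTheory.EllipticCurves.Zhang2014.levelIndex W 2 n)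
    (hne : d.kolyvaginClass Nat.prime_two M ≠ 0) :
    ∃ (n₀ : ℕ) (d₀ : Literature.NumberTheory.EllipticCurves.KolyvaginHeegnerData Dt β ι n₀) (M₀ : ℕ),
      Literature.NumberTheory.EllipticCurves.KolyvaginDescent.KolSupp
        (Literature.NumberTheory.EllipticCurves.Zhang2014.IsKolyvaginPrime (W.conductorNorm ℤ) W K 2) n₀ ∧
      1 ≤ M₀ ∧ ((M₀ + k : ℕ) : ℕ∞) ≤ Literature.NumberTheory.EllipticCurves.Zhang2014.levelIndex W 2 n₀ ∧
      d₀.kolyvaginClass Nat.prime_two M₀ ≠ 0 ∧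
      ∀ (n' : ℕ) (d' : Literature.NumberTheory.EllipticCurves.KolyvaginHeegnerData Dt β ι n') (M' : ℕ),
        Literature.NumberTheory.EllipticCurves.KolyvaginDescent.KolSupp
          (Literature.NumberTheory.EllipticCurves.Zhang2014.IsKolyvaginPrime (W.conductorNorm ℤ) W K 2) n' →
        1 ≤ M' → ((M' + k : ℕ) : ℕ∞) ≤ Literature.NumberTheory.EllipticCurves.Zhang2014.levelIndex W 2 n' →
        d'.kolyvaginClass Nat.prime_two M' ≠ 0 → n₀.primeFactors.card ≤ n'.primeFactors.card := by
  let P : ℕ → Prop := fun c ↦ ∃ (n' : ℕ)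
    (d' : Literature.NumberTheory.EllipticCurves.KolyvaginHeegnerData Dt β ι n') (M' : ℕ),
    Literature.NumberTheory.EllipticCurves.KolyvaginDescent.KolSupp
      (Literature.NumberTheory.EllipticCurves.Zhang2014.IsKolyvaginPrime (W.conductorNorm ℤ) W K 2) n' ∧
      1 ≤ M' ∧ ((M' + k : ℕ) : ℕ∞) ≤ Literature.NumberTheory.EllipticCurves.Zhang2014.levelIndex W 2 n' ∧
      d'.kolyvaginClass Nat.prime_two M' ≠ 0 ∧ n'.primeFactors.card = c
  have hex : ∃ c, P c := ⟨_, n, d, M, hn, hM, hMle, hne, rfl⟩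
  obtain ⟨n₀, d₀, M₀, hn₀, hM₀, hM₀le, hne₀, hk₀⟩ := Nat.find_spec hex
  refine ⟨n₀, d₀, M₀, hn₀, hM₀, hM₀le, hne₀, fun n' d' M' hn' hM' hM'le hne' ↦ ?_⟩
  rw [hk₀]
  exact Nat.find_min' hex ⟨n', d', M', hn', hM', hM'le, hne', rfl⟩

/-- **The deciding theorem with the margin pair** — the route's `closes` VERBATIM except that V1′ₛ
supplies a class of the margin `k` that V2♭ₘ asks for, and minimality is taken among margin-`k`
classes. It concludes the registered leaf `Rank1Residual.NonCMTwoConverse`.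
[cite: Kolyvagin1991MathAnn, §2] [cite: GrossZagier1986, I (6.1)] -/
theorem closes_margin (hV1 : KolyvaginNonvanishingAtTwoFrameStrong)
    (hV2 : KolyvaginCorankLowerBoundAtTwoMargin)
    (hR : OffHabitatNonSurjTwoConverse) (hIn : PrintedInputsRankOneAtTwo) (hT : NoTwoTorsionOverK)
    (hf : BFHTwistSupply) (h0 : SimpleZeroTwistSplitAtTwoOfBFH) (hGZK : MultPublishedInputsAtTwo)
    (hMod : NewformOfEllipticCurve) (hHLT : HoffsteinLuoNonvanishingTwist) (hEnt : EntireLFunctionRat) :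
    Summit.BirchSwinnertonDyer.BirchSwinnertonDyer.Rank1Residual.NonCMTwoConverse := by
  have hBFH : SimpleZeroTwistSplitAtTwo := h0 hf
  intro W _ _ hCM hred r hr hc
  by_cases hsur : (∀ m : ℕ, W.HasSurjectiveModNGaloisRep (2 ^ m : ℕ))
  swap
  · exact hR W hCM hred r hr hc hsur
  obtain ⟨-, -, hpar, hKato, -, hGZ, hrec⟩ := hIn
  have hmod : Literature.NumberTheory.EllipticCurves.ModularForms.exists_isNewformOf := hMod
  have hHL : Literature.NumberTheory.EllipticCurves.HoffsteinLuo1997_exists_twist_L_one_ne_zero := hHLT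
  have hE : WeierstrassCurve.hasEntireLFunction_rat := hEnt
  have hGZK' : Literature.NumberTheory.EllipticCurves.rank_eq_analyticRank_of_analyticRank_le_one := hGZK
  haveI : Fact (Nat.Prime 2) := ⟨Nat.prime_two⟩
  haveI : NeZero (W.conductorNorm ℤ) := ⟨(W.conductorNorm_pos_holds).ne'⟩
  obtain rfl | rfl : r = 0 ∨ r = 1 := by omega
  · -- ===== r = 0 : partner twist with a simple zero (BFH 1990 (i), `2` split) =====
    have hw : W.rootNumber = 1 := by
      have h := hpar W
      unfold Literature.NumberTheory.EllipticCurves.p_parity at h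
      rw [hc, pow_zero] at h
      exact h.symm
    obtain ⟨K, _, _, hK, -, hHN, hH2, hd8, hL0, hL1⟩ := hBFH W hw 0
    have hodd : Odd (NumberField.discr K) := by
      rw [Int.odd_iff]; omega
    have hne3 : NumberField.discr K ≠ -3 := by omega
    have hne4 : NumberField.discr K ≠ -4 := by omega
    have h2d : ¬ ((2 : ℤ) ∣ NumberField.discr K) := by omega
    have hd : (NumberField.discr K : ℚ) ≠ 0 := by exact_mod_cast NumberField.discr_ne_zero K
    haveI := W.isElliptic_quadraticTwist hd
    have hr1 : (W.quadraticTwist (NumberField.discr K : ℚ)).analyticRank = 1 :=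
      Literature.NumberTheory.EllipticCurves.analyticRank_eq_one_of_entireLFunction_one_eq_zero_of_deriv_ne_zero
        _ (hE _) hL0 hL1
    obtain ⟨hrk, hsha⟩ := hGZK' (W.quadraticTwist (NumberField.discr K : ℚ)) (le_of_eq hr1)
    rw [hr1] at hrk
    haveI := hsha
    have hc' : (W.quadraticTwist (NumberField.discr K : ℚ)).selmerCorank 2 = 1 :=
      Literature.NumberTheory.EllipticCurves.selmerCorank_eq_one_of_mordellWeilRank_eq_one_of_finite
        (W.quadraticTwist (NumberField.discr K : ℚ)) 2 hrk inferInstance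
    have htor := hT W hsur K hK
    obtain ⟨fW, hfW⟩ := hMod W
    obtain ⟨Dt⟩ :=
      Literature.NumberTheory.Automorphic.nonempty_modularParametrizationData_of_isNewformOf hfW
    obtain ⟨β, hβ⟩ := Literature.NumberTheory.EllipticCurves.exists_dvd_sq_sub_discr_holds (W.conductorNorm ℤ) K hK hHN
    obtain ⟨ι⟩ := (inferInstance : Nonempty (K →+* ℂ))
    obtain ⟨k, hV2k⟩ := hV2 W hCM hred hsur K hK hne3 hne4 h2d hHN
    obtain ⟨n, d, M, hn, hM1, hMle, hne⟩ := hV1 W hCM hred hsur K hK hHN hodd hne3 htor hH2 Dt β ι hβ k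
    obtain ⟨n₀, d₀, M₀, hn₀, hM₀, hM₀le, hne₀, hmin⟩ :=
      exists_minimal_kolyvaginClass_ne_zero_margin k d hn hM1 hMle hne
    -- the ONLY use of V2 (weakened): the lower bound `ν + 1 ≤ max(c, c') = 1` forces `ν = 0`
    have hstruct := hV2k Dt β ι n₀ d₀ M₀ hn₀ hM₀ hM₀le hne₀ hmin
    have hν : n₀.primeFactors.card = 0 := by
      rcases hstruct with h1 | h1 <;> omega
    have hn1 : n₀ = 1 := by
      rw [Finset.card_eq_zero, Nat.primeFactors_eq_empty] at hν
      rcases hν with h0 | h1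
      · exact absurd (h0 ▸ hn₀.1) not_squarefree_zero
      · exact h1
    subst hn1
    have hEK : Literature.NumberTheory.EllipticCurves.analyticRankEK W K = 1 :=
      Literature.NumberTheory.EllipticCurves.heegnerSystem_analyticRankEK_eq_one_of_kolyvaginClass_one_ne_zero
        (hGZ W _ K) (hrec _ W K) hK rfl hHN d₀ hne₀
    rw [Literature.NumberTheory.EllipticCurves.analyticRankEK_eq_add_of hE W K, hr1] at hEK
    omega
  · -- ===== r = 1 : partner twist with L(E^{(d_K)}, 1) ≠ 0 (Hoffstein–Luo) =====
    have hw : W.rootNumber = -1 := by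
      have h := hpar W
      unfold Literature.NumberTheory.EllipticCurves.p_parity at h
      rw [hc, pow_one] at h
      exact h.symm
    obtain ⟨K, _, _, hK, -, hHN, hH2, hd8, hL1⟩ :=
      Literature.NumberTheory.EllipticCurves.exists_heegnerField_split_twist_ne_zero_discr_emod_eight_of_hoffsteinLuo
        hmod hHL W hw Nat.prime_two 0
    have hodd : Odd (NumberField.discr K) := by
      rw [Int.odd_iff]; omega
    have hne3 : NumberField.discr K ≠ -3 := by omega
    have hne4 : NumberField.discr K ≠ -4 := by omega
    have h2d : ¬ ((2 : ℤ) ∣ NumberField.discr K) := by omega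
    have hd : (NumberField.discr K : ℚ) ≠ 0 := by exact_mod_cast NumberField.discr_ne_zero K
    haveI := W.isElliptic_quadraticTwist hd
    obtain ⟨-, -, hfin⟩ := hKato (W.quadraticTwist (NumberField.discr K : ℚ)) hL1
    haveI := hfin
    have hc' : (W.quadraticTwist (NumberField.discr K : ℚ)).selmerCorank 2 = 0 :=
      (W.quadraticTwist (NumberField.discr K : ℚ)).selmerCorank_eq_zero_of_finite 2
    have htor := hT W hsur K hK
    obtain ⟨fW, hfW⟩ := hMod W
    obtain ⟨Dt⟩ :=
      Literature.NumberTheory.Automorphic.nonempty_modularParametrizationData_of_isNewformOf hfW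
    obtain ⟨β, hβ⟩ := Literature.NumberTheory.EllipticCurves.exists_dvd_sq_sub_discr_holds (W.conductorNorm ℤ) K hK hHN
    obtain ⟨ι⟩ := (inferInstance : Nonempty (K →+* ℂ))
    obtain ⟨k, hV2k⟩ := hV2 W hCM hred hsur K hK hne3 hne4 h2d hHN
    obtain ⟨n, d, M, hn, hM1, hMle, hne⟩ := hV1 W hCM hred hsur K hK hHN hodd hne3 htor hH2 Dt β ι hβ k
    obtain ⟨n₀, d₀, M₀, hn₀, hM₀, hM₀le, hne₀, hmin⟩ :=
      exists_minimal_kolyvaginClass_ne_zero_margin k d hn hM1 hMle hne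
    -- the ONLY use of V2 (weakened): the lower bound `ν + 1 ≤ max(c, c') = 1` forces `ν = 0`
    have hstruct := hV2k Dt β ι n₀ d₀ M₀ hn₀ hM₀ hM₀le hne₀ hmin
    have hν : n₀.primeFactors.card = 0 := by
      rcases hstruct with h1 | h1 <;> omega
    have hn1 : n₀ = 1 := by
      rw [Finset.card_eq_zero, Nat.primeFactors_eq_empty] at hν
      rcases hν with h0 | h1
      · exact absurd (h0 ▸ hn₀.1) not_squarefree_zero
      · exact h1
    subst hn1
    have hEK : Literature.NumberTheory.EllipticCurves.analyticRankEK W K = 1 :=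
      Literature.NumberTheory.EllipticCurves.heegnerSystem_analyticRankEK_eq_one_of_kolyvaginClass_one_ne_zero
        (hGZ W _ K) (hrec _ W K) hK rfl hHN d₀ hne₀
    rw [Literature.NumberTheory.EllipticCurves.analyticRankEK_eq_add_of hE W K,
      Literature.NumberTheory.EllipticCurves.analyticRank_eq_zero_of_entireLFunction_one_ne_zero _ hL1,
      add_zero] at hEK
    exact hEK


end Summit.BirchSwinnertonDyer.BirchSwinnertonDyer.Theses.KolyvaginRankRigidityAtTwo.MarginTurnkey
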